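import Summits.CriticalPhenomena.SAWScalingLimit.Theorems.SAWDevelopingMapObservableToSLETypeLadderCarvedReductionSqueezeCorridor
import HarnessLib

/-!
# The corridor of ONE gate with the squeeze's radii, and where it lies (piece (T-A′ P1-gate) of
# stub T-A′ `stub_carvedReduction_squeezeGeometry_domains`)

Crux `SAWDevelopingMap.ObservableToSLE` (stmt-CriticalPhenomena-10472), line `six-class-type-ladder`,
stub T-A′ `stub_carvedReduction_squeezeGeometry_domains`.  Landing target:
`Summits/CriticalPhenomena/SAWScalingLimit/Theorems/SAWDevelopingMapObservableToSLETypeLadderCarvedReductionSqueezeGateCorridor.lean`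
(`--supports stmt-CriticalPhenomena-10472`; registered carrier `stub_carvedReduction_gateCorridor`).
Specialisation of `stub_carvedReduction_corridor` (p143497) to the radii of the squeeze (worker log
E3): frame half-width `ρ' = ρ/64` (= `ρc`), frame depth `h = ρ/128` (= `ρc'`), flatness radius
`ρw = ρ/128`, low box `W₁ = ρ/16`, `H₁ = 7ρ/16`, body-zone radius `r₂' = ρ/8`, margin `μ = ρ/64`.

For one gate `P` with window radius `ρ`, pinned root `α` (`dist P α ≤ R`), limit body `B`
(connected, `∋ P - (ρ/2) i`, `⊆ closedBall α R`, `ρ/4` off the open upper half-ball) and exit zone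
`F` (open, connected, inside `J`, off `ball P (ρ/2)`, meeting the body zone), inside an envelope
`J ⊇ ball P (ρ/2) ∪ closedBall α (R + ρ)`: the corridor `O = (V ∖ K) ∪ {infDist · B < ρ/8} ∪ F`
satisfies the per-gate hypotheses of `stub_carvedReduction_superFrame`, and moreover
`O ∪ R_P ⊆ F ∪ {infDist · B < ρ/8} ∪ ({im ≤ im P} ∩ closedBall P (ρ/2 - ρ/64))` (the avoided set
of `…WalkOffZones` / `…ReachSup`), the open upper half-disc `{im > im P} ∩ ball P ρw` misses
`O ∪ R_P`, and `O ∪ R_P ∪ closedBall P ρw ⊆ F ∪ ball α (R + ρ)` (separation of the two gates).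
-/

noncomputable section
open scoped Topology
open Filter Set Metric
open Literature.Probability.RandomPlanarGeometry

namespace Summit.CriticalPhenomena.SAWScalingLimit.Theorems.ObservableToSLE.TypeLadder

/-- **Registered carrier `stub_carvedReduction_gateCorridor`** (crux item stmt-CriticalPhenomena-10472,
stub T-A′ `stub_carvedReduction_squeezeGeometry_domains`, piece THE CORRIDOR OF ONE GATE WITH THE
SQUEEZE'S RADII); see the module docstring. -/
theorem stub_carvedReduction_gateCorridor :
    ∀ (J B F : Set ℂ) (P α : ℂ) (ρ R : ℝ), 0 < ρ → dist P α ≤ R →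
      ball P (ρ / 2) ⊆ J → closedBall α (R + ρ) ⊆ J →
      IsConnected B → P - ((ρ / 2 : ℝ) : ℂ) * Complex.I ∈ B → B ⊆ closedBall α R →
      (∀ b ∈ B, ∀ z : ℂ, dist z P < ρ / 2 → P.im < z.im → ρ / 4 ≤ dist b z) →
      IsOpen F → IsConnected F → F ⊆ J → Disjoint F (ball P (ρ / 2)) → (F ∩ {z : ℂ | infDist z B < ρ / 8}).Nonempty →
      let O : Set ℂ := ({z : ℂ | |z.re - P.re| < ρ / 16 ∧ P.im - 7 * ρ / 16 < z.im ∧ z.im < P.im - ρ / 128} \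
          closedBall (P - ((ρ / 128 : ℝ) : ℂ) * Complex.I) (ρ / 64)) ∪ {z : ℂ | infDist z B < ρ / 8} ∪ F
      IsOpen O ∧ IsConnected O ∧ O ⊆ J ∧
      Disjoint O {z : ℂ | |z.re - P.re| ≤ ρ / 64 ∧ P.im - ρ / 128 ≤ z.im ∧ z.im ≤ P.im} ∧
      Disjoint O (closedBall P (ρ / 128)) ∧
      Disjoint O (closedBall (P - ((ρ / 128 : ℝ) : ℂ) * Complex.I) (ρ / 64)) ∧
      segment ℝ (P - ((ρ / 128 : ℝ) : ℂ) * Complex.I - ((ρ / 64 : ℝ) : ℂ))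
          (P - ((ρ / 128 : ℝ) : ℂ) * Complex.I - ((ρ / 64 : ℝ) : ℂ) - (((ρ / 64) / 2 : ℝ) : ℂ) * Complex.I) \
        {P - ((ρ / 128 : ℝ) : ℂ) * Complex.I - ((ρ / 64 : ℝ) : ℂ)} ⊆ O ∧
      segment ℝ (P - ((ρ / 128 : ℝ) : ℂ) * Complex.I + ((ρ / 64 : ℝ) : ℂ))
          (P - ((ρ / 128 : ℝ) : ℂ) * Complex.I + ((ρ / 64 : ℝ) : ℂ) - (((ρ / 64) / 2 : ℝ) : ℂ) * Complex.I) \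
        {P - ((ρ / 128 : ℝ) : ℂ) * Complex.I + ((ρ / 64 : ℝ) : ℂ)} ⊆ O ∧
      {z : ℂ | |z.re - P.re| ≤ ρ / 64 ∧ P.im - ρ / 128 ≤ z.im ∧ z.im ≤ P.im} ⊆ J ∧
      closedBall P (ρ / 128) ⊆ J ∧ closedBall (P - ((ρ / 128 : ℝ) : ℂ) * Complex.I) (ρ / 64) ⊆ J ∧
      O ∪ {z : ℂ | |z.re - P.re| ≤ ρ / 64 ∧ P.im - ρ / 128 ≤ z.im ∧ z.im ≤ P.im} ⊆
        F ∪ {z : ℂ | infDist z B < ρ / 8} ∪ ({z : ℂ | z.im ≤ P.im} ∩ closedBall P (ρ / 2 - ρ / 64)) ∧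
      Disjoint ({z : ℂ | P.im < z.im} ∩ ball P (ρ / 128))
        (O ∪ {z : ℂ | |z.re - P.re| ≤ ρ / 64 ∧ P.im - ρ / 128 ≤ z.im ∧ z.im ≤ P.im}) ∧
      O ∪ {z : ℂ | |z.re - P.re| ≤ ρ / 64 ∧ P.im - ρ / 128 ≤ z.im ∧ z.im ≤ P.im} ∪ closedBall P (ρ / 128) ⊆
        F ∪ ball α (R + ρ) := by
  intro J B F P α ρ R hρ hPα hballJ hαJ hBc hgB hBα hBfar hFo hFc hFJ hFball hFZ O
  -- the near sets lie in `ball P (ρ/2)`, in fact within `ρ/2 - ρ/64` below or near the line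
  have hnear : ∀ z : ℂ, |z.re - P.re| + |z.im - P.im| < ρ / 2 → z ∈ ball P (ρ / 2) := fun z hz =>
    mem_ball.2 ((dist_le_abs_re_add_abs_im z P).trans_lt (by rwa [Complex.sub_re, Complex.sub_im]))
  have hRsub : {z : ℂ | |z.re - P.re| ≤ ρ / 64 ∧ P.im - ρ / 128 ≤ z.im ∧ z.im ≤ P.im} ⊆
      {z : ℂ | z.im ≤ P.im} ∩ closedBall P (ρ / 2 - ρ / 64) := by
    rintro z ⟨hre, him1, him2⟩
    refine ⟨him2, mem_closedBall.2 ((dist_le_abs_re_add_abs_im z P).trans ?_)⟩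
    rw [Complex.sub_re, Complex.sub_im]
    have : |z.im - P.im| ≤ ρ / 128 := by rw [abs_le]; constructor <;> linarith
    linarith
  have hVsub : {z : ℂ | |z.re - P.re| < ρ / 16 ∧ P.im - 7 * ρ / 16 < z.im ∧ z.im < P.im - ρ / 128} \
      closedBall (P - ((ρ / 128 : ℝ) : ℂ) * Complex.I) (ρ / 64) ⊆ {z : ℂ | z.im ≤ P.im} ∩ closedBall P (ρ / 2 - ρ / 64) := by
    rintro z ⟨⟨hre, him1, him2⟩, -⟩
    refine ⟨by show z.im ≤ P.im; linarith, mem_closedBall.2 ?_⟩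
    have hd2 : dist z P ^ 2 = (z.re - P.re) ^ 2 + (z.im - P.im) ^ 2 := by
      rw [dist_eq_norm, Complex.sq_norm, Complex.normSq_apply]; simp; ring
    have hre2 : (z.re - P.re) ^ 2 < (ρ / 16) ^ 2 := by
      have := abs_lt.1 hre; nlinarith
    have him2' : (z.im - P.im) ^ 2 < (7 * ρ / 16) ^ 2 := by nlinarith
    have hlt : dist z P ^ 2 < (ρ / 2 - ρ / 64) ^ 2 := by rw [hd2]; nlinarith
    exact le_of_lt (lt_of_pow_lt_pow_left₀ 2 (by linarith) hlt)
  have hZJ : {z : ℂ | infDist z B < ρ / 8} ⊆ J :=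
    (infDistZone_subset_ball hBα ⟨_, hgB⟩).trans ((ball_subset_closedBall.trans
      (closedBall_subset_closedBall (by linarith))).trans hαJ)
  obtain ⟨hOo, hOc, hOJ, hOR, hOB, hOK, hdL, hdR, hObulk⟩ :=
    stub_carvedReduction_corridor J B F P ρ (ρ / 64) (ρ / 128) (ρ / 128) (ρ / 16) (7 * ρ / 16) (ρ / 8)
      (by positivity) le_rfl (by positivity) (by linarith) (by linarith) (by linarith) (by linarith) (by positivity)
      (by linarith) (by linarith) hballJ hBc hgB hBfar hZJ hFo hFc hFJ hFball hFZ
  have hcast : ((ρ / 128 : ℝ) : ℂ) = ((ρ / 128 : ℝ) : ℂ) := rfl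
  refine ⟨hOo, hOc, hOJ, hOR, hOB, hOK, ?_, ?_, ?_, ?_, ?_, ?_, ?_, ?_⟩
  · exact hdL
  · exact hdR
  · exact fun z hz => hballJ (hnear z (by
      have : |z.im - P.im| ≤ ρ / 128 := by rw [abs_le]; constructor <;> linarith [hz.2.1, hz.2.2]
      linarith [hz.1]))
  · exact (closedBall_subset_ball (by linarith)).trans hballJ
  · intro z hz
    refine hballJ (mem_ball.2 ?_)
    calc dist z P ≤ dist z (P - ((ρ / 128 : ℝ) : ℂ) * Complex.I) + dist (P - ((ρ / 128 : ℝ) : ℂ) * Complex.I) P :=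
          dist_triangle _ _ _
      _ ≤ ρ / 64 + ρ / 128 := by
          refine add_le_add (mem_closedBall.1 hz) ?_
          rw [dist_eq_norm, show P - ((ρ / 128 : ℝ) : ℂ) * Complex.I - P = -(((ρ / 128 : ℝ) : ℂ) * Complex.I) by ring,
            norm_neg, norm_mul, Complex.norm_real, Complex.norm_I, mul_one, Real.norm_of_nonneg (by positivity)]
      _ < ρ / 2 := by linarith
  · -- `O ∪ R ⊆ X`
    rintro z (((hz | hz) | hz) | hz)
    · exact Or.inr (hVsub (by simpa using hz))
    · exact Or.inl (Or.inr hz)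
    · exact Or.inl (Or.inl hz)
    · exact Or.inr (hRsub hz)
  · -- the open upper half-disc misses `O ∪ R`
    refine Set.disjoint_left.2 fun z hz hz' => ?_
    rcases hz' with hzO | hzR
    · exact Set.disjoint_left.1 hObulk hzO ⟨hz.1, ball_subset_ball (by linarith) hz.2⟩
    · have : z.im ≤ P.im := hzR.2.2
      exact absurd hz.1 (not_lt.2 this)
  · -- everything near the gate lies in `F ∪ ball α (R + ρ)`
    have hballα : ball P (ρ / 2) ⊆ ball α (R + ρ) := fun z hz => by
      rw [mem_ball] at hz ⊢; linarith [dist_triangle z P α]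
    rintro z ((((hz | hz) | hz) | hz) | hz)
    · exact Or.inr (hballα (hnear z (by
        obtain ⟨⟨hre, him1, him2⟩, -⟩ := (by simpa using hz :
          z ∈ {z : ℂ | |z.re - P.re| < ρ / 16 ∧ P.im - 7 * ρ / 16 < z.im ∧ z.im < P.im - ρ / 128} \
            closedBall (P - ((ρ / 128 : ℝ) : ℂ) * Complex.I) (ρ / 64))
        rw [abs_of_neg (by linarith : z.im - P.im < 0)]; linarith)))
    · refine Or.inr ?_
      have := infDistZone_subset_ball (r := ρ / 8) hBα ⟨_, hgB⟩ hz
      exact ball_subset_ball (by linarith) this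
    · exact Or.inl hz
    · exact Or.inr (hballα (hnear z (by
        have : |z.im - P.im| ≤ ρ / 128 := by rw [abs_le]; constructor <;> linarith [hz.2.1, hz.2.2]
        linarith [hz.1])))
    · exact Or.inr (hballα (closedBall_subset_ball (by linarith) hz))

end Summit.CriticalPhenomena.SAWScalingLimit.Theorems.ObservableToSLE.TypeLadder

end
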